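import Summits.ResolutionOfSingularities.ResolutionOfSingularities.Theorems.EquisingularLiftEquisingularLiftNatFlatQuotientRegularSequence
import Summits.ResolutionOfSingularities.ResolutionOfSingularities.Theorems.EquisingularLiftEquisingularLiftNatEmbeddedLiftTorsorLaws
import Mathlib.RingTheory.Ideal.Quotient.Operations
import HarnessLib

/-!
# [OURS · L1 W4.5(b) · EL♮(3) · (T-k) · J1c brick (λ)] Local existence of a flat lift with PRESCRIBED reduction — R. Hartshorne, *Deformation
# Theory* (2010), Thm. 9.2 (b)/(c) on an affine piece, ring level over an Artinian local base

Crux chain w45b (cell `res-hironaka`, slot W4.5(b)), crux **EL♮(3)** = stmt-ResolutionOfSingularities-20148; NEED-FACT of record J1 =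
`EmbeddedInfinitesimalLiftFact` (p596985). Written by res-type-027 g16 (J1c design `Cruxes/EquisingularLiftNatThree/Lines/J1c-DESIGN-res-type-027.md`,
brick (λ)), over J1a (…NatFlatQuotientRegularSequence p598761) and the laws (…NatEmbeddedLiftTorsorLaws p600680). HONEST FRAMING: OURS; NOT a statement of
H. Hironaka's 2017 manuscript; AI-written, gate-checked, weaker than expert review. No `sorry`; standard axioms; DEF-FREE.
`--supports stmt-ResolutionOfSingularities-20148 --as helper`.
* `exists_flat_lift_eq_of_isWeaklyRegular_fiber` — `C'` Artinian local, `J ≤ 𝔪` (the previous level `C = C'/J`), `A'` flat over `C'`, `A = A'/JA'`,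
  `I ⊆ A` with `A/I` flat over `C'/J`; a list `a' ⊆ A'` weakly regular on the fibre `A'/𝔪A'`, with image in `I` generating `I` modulo `𝔪`. THEN
  `A'/(a')` is flat over `C'` (J1a) AND `(a')·A = I` exactly (`eq_of_le_of_le_sup_map_of_flat` at level `C'/J`, `𝔪̄` nilpotent by
  `IsArtinianRing.isNilpotent_jacobson_bot`). This is the affine local-existence step of Hartshorne's proof of Thm. 6.2 (b)/22.3 (lift the generators).
References (method / index only): R. Hartshorne, *Deformation Theory* (2010), Thm. 9.2 (b), (c), p. 87.
-/

set_option linter.dupNamespace false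

noncomputable section

open IsLocalRing RingTheory.Sequence

namespace Summit.ResolutionOfSingularities.ResolutionOfSingularities.Cruxes.EquisingularLiftNat.Sections

universe u v

variable {C' : Type u} [CommRing C'] [IsLocalRing C'] [IsArtinianRing C'] {A' : Type v} [CommRing A'] [Algebra C' A'] [Module.Flat C' A']

/-- **(λ) Local existence of the lift** (Hartshorne 2010, Thm. 9.2 (b): «If `a'_1, …, a'_r` are any liftings of the `a_i` to `A'`, then … defines a
quotient `B' = A'/I'`, flat over `C'`, with `B' ×_{C'} C = B`»), ring level over an Artinian local base `C'` with a nilpotent ideal `J` cutting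
the previous level `C = C'/J`, `A = A'/JA'`: if `A'` is flat over `C'`, `I ⊆ A` has `A/I` flat over `C`, and `a'` is a list in `A'` whose image in
the fibre `A'/𝔪A'` is weakly regular, whose image in `A` lies in `I` and generates `I` modulo `𝔪` — then `I' := (a')` has `A'/I'` flat over
`C'` (J1a) and reduces EXACTLY to `I` (`eq_of_le_of_le_sup_map_of_flat` at level `C`). [cite: Hartshorne2010, Thm. 9.2 (b), (c)]
[OURS · L1 W4.5b · (T-k) J1c (λ)] toward `stub_elnat_embeddedInfinitesimalLiftFact`; NOT a statement of the manuscript. -/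
theorem exists_flat_lift_eq_of_isWeaklyRegular_fiber (J : Ideal C') (hJ : J ≤ maximalIdeal C')
    (I : Ideal (A' ⧸ J.map (algebraMap C' A')))
    [Module.Flat (C' ⧸ J) ((A' ⧸ J.map (algebraMap C' A')) ⧸ I)]
    (as' : List A') (hreg : IsWeaklyRegular (A' ⧸ (maximalIdeal C').map (algebraMap C' A')) as')
    (hmem : ∀ a ∈ as', Ideal.Quotient.mk (J.map (algebraMap C' A')) a ∈ I)
    (hgen : I ≤ (Ideal.ofList as').map (Ideal.Quotient.mk (J.map (algebraMap C' A'))) ⊔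
      (maximalIdeal C').map (algebraMap C' (A' ⧸ J.map (algebraMap C' A')))) :
    Module.Flat C' (A' ⧸ Ideal.ofList as') ∧ (Ideal.ofList as').map (Ideal.Quotient.mk (J.map (algebraMap C' A'))) = I := by
  have _ := hJ
  refine ⟨(isWeaklyRegular_and_flat_quotient_of_isWeaklyRegular_fiber (A := C') hreg).2, ?_⟩
  -- the reduction `(a')·A ≤ I`, equal modulo `𝔪`, `A/I` flat over `C'/J` ⇒ equal
  have hle : (Ideal.ofList as').map (Ideal.Quotient.mk (J.map (algebraMap C' A'))) ≤ I := by
    rw [Ideal.map_ofList, Ideal.ofList, Ideal.span_le]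
    intro y hy
    obtain ⟨a, ha, rfl⟩ := List.mem_map.mp hy
    exact hmem a ha
  have hnil : IsNilpotent ((maximalIdeal C').map (Ideal.Quotient.mk J)) := by
    obtain ⟨n, hn⟩ := IsArtinianRing.isNilpotent_jacobson_bot (R := C')
    have h𝔪n : maximalIdeal C' ^ n = 0 := by
      rw [← IsLocalRing.jacobson_eq_maximalIdeal ⊥ bot_ne_top]; exact hn
    exact ⟨n, by rw [← Ideal.map_pow, h𝔪n, Ideal.zero_eq_bot, Ideal.map_bot]; exact Ideal.zero_eq_bot.symm⟩
  have hmap : ((maximalIdeal C').map (Ideal.Quotient.mk J)).map (algebraMap (C' ⧸ J) (A' ⧸ J.map (algebraMap C' A'))) =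
      (maximalIdeal C').map (algebraMap C' (A' ⧸ J.map (algebraMap C' A'))) := by
    rw [Ideal.map_map, IsScalarTower.algebraMap_eq C' (C' ⧸ J) (A' ⧸ J.map (algebraMap C' A')), Ideal.Quotient.algebraMap_eq]
  have hgen' : I ≤ (Ideal.ofList as').map (Ideal.Quotient.mk (J.map (algebraMap C' A'))) ⊔
      ((maximalIdeal C').map (Ideal.Quotient.mk J)).map (algebraMap (C' ⧸ J) (A' ⧸ J.map (algebraMap C' A'))) := by
    rw [hmap]; exact hgen
  exact eq_of_le_of_le_sup_map_of_flat ((maximalIdeal C').map (Ideal.Quotient.mk J)) hnil _ I hle hgen'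

end Summit.ResolutionOfSingularities.ResolutionOfSingularities.Cruxes.EquisingularLiftNat.Sections

end
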